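import Mathlib
import Summits.ValiantsHypothesis.ValiantsHypothesis.Theorems.GrenetZeonTwoDimCoefficientsGradedHessianSlots
import Summits.ValiantsHypothesis.ValiantsHypothesis.Theorems.GrenetZeonTwoDimCoefficientsGradedSlotFactors
import Summits.ValiantsHypothesis.ValiantsHypothesis.Theorems.GrenetZeonTwoDimCoefficientsGradedPathFactor

/-!
# Crux `GrenetZeon.TwoDimCoefficients` (stmt-ValiantsHypothesis-8062) / rung `DualUnipotentThreeHalves` (stmt-24318):
# the graded Hessian under an ADMISSIBLE PIVOT ASSIGNMENT (Theorem T7, kernel plan step 4b)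

Memo TWENTY-SECOND HAND §2/§4.  Composition of ✓ `rank_hess0_graded_le_two_mul_sum_slot` (step 4a), the two-pivot slot
lemma ✓ `finrank_range_slot_le` (step 3) and the pivot factorization of the graded resolvent ✓ `resolvent_apply_eq_sum_level`
(step 2): for a consecutive-graded affine pencil `N`, affine `M`, a point `p`, and ANY assignment of pivot levels
`ℓ ↦ (p⁻ ℓ, p⁺ ℓ)` that is admissible (`p⁻ + 1 ≤ ℓ`, `ℓ + 2 ≤ p⁺ ≤ p⁻ + n`) on a set `adm` of slots,

  `rank Hess_p tr(N^{n−1}·M) ≤ 2·Σ_{ℓ<H} [adm ℓ ? w_ℓ·w_{p⁺ℓ} + w_{ℓ+1}·(w_{p⁻ℓ} + w_{p⁺ℓ}) : w_{ℓ+1}·w_ℓ]`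

(`w_q = #{i : lvl i = q}`).  What remains for the rate `C·m²/n` (step 5) is the CHOICE of pivots (minimum-width level of each
segment of `≈ n/4` consecutive levels) and the banded accounting of the memo — pure arithmetic on the widths.

* ★ `rank_hess0_graded_le_of_pivots` — the statement above.

HONEST FRAMING: a brick; the stub `DualUnipotentBound`, the 24318 decl and `VP ≠ VNP` remain open.

References: folklore linear algebra.
-/

set_option linter.dupNamespace false
set_option autoImplicit false

noncomputable section

namespace Summit.ValiantsHypothesis.ValiantsHypothesis.Theorems.GrenetZeonTwoDimCoefficients.GradedHessianPivots

open Module Matrix MvPolynomial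
open Literature.Computability.AlgebraicComplexity
open Summit.ValiantsHypothesis.ValiantsHypothesis.Cruxes.TwoDimCoefficients.DimTwoCases (AffMat IsAffine)
open Summit.ValiantsHypothesis.ValiantsHypothesis.Theorems.GrenetZeonTwoDimCoefficients.GradedTopTrace
  (pow_eq_zero_of_graded)
open Summit.ValiantsHypothesis.ValiantsHypothesis.Theorems.GrenetZeonTwoDimCoefficients.GradedPathFactor
  (resolvent_apply_eq_sum_level)
open Summit.ValiantsHypothesis.ValiantsHypothesis.Theorems.GrenetZeonTwoDimCoefficients.GradedSlotFactors
  (finrank_range_slot_le)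
open Summit.ValiantsHypothesis.ValiantsHypothesis.Theorems.GrenetZeonTwoDimCoefficients.GradedHessianSlots
  (rank_hess0_graded_le_two_mul_sum_slot)

variable {n m : ℕ} (lvl : Fin m → ℕ)

/-- ★ **The graded Hessian under an admissible pivot assignment.**  `N` consecutive-graded affine, `M` affine,
`n − 1 < m`, levels `< H`; pivots `p⁻ ℓ`, `p⁺ ℓ` admissible on `adm`:
`rank Hess_p tr(N^{n−1}·M) ≤ 2·Σ_{ℓ<H} [adm ℓ ? w_ℓ·w_{p⁺ℓ} + w_{ℓ+1}·(w_{p⁻ℓ} + w_{p⁺ℓ}) : w_{ℓ+1}·w_ℓ]`. [folklore] -/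
theorem rank_hess0_graded_le_of_pivots (N M : AffMat n m) (hN : IsAffine N) (hM : IsAffine M)
    (hgr : ∀ a b, lvl b ≠ lvl a + 1 → N a b = 0) (hnm : n - 1 < m) (H : ℕ) (hH : ∀ i, lvl i < H)
    (p : Fin n × Fin n → ℂ) (pm pp : ℕ → ℕ) (adm : ℕ → Prop) [DecidablePred adm]
    (hadm : ∀ ℓ, adm ℓ → pm ℓ + 1 ≤ ℓ ∧ ℓ + 2 ≤ pp ℓ ∧ pp ℓ ≤ pm ℓ + (n - 1) + 1) :
    (hess0 (transl p ((N ^ (n - 1) * M).trace))).rank ≤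
      2 * ∑ ℓ ∈ Finset.range H,
        (if adm ℓ then
          Fintype.card {j : Fin m // lvl j = ℓ} * Fintype.card {c : Fin m // lvl c = pp ℓ} +
            Fintype.card {i : Fin m // lvl i = ℓ + 1} *
              (Fintype.card {c : Fin m // lvl c = pm ℓ} + Fintype.card {c : Fin m // lvl c = pp ℓ})
        else Fintype.card {i : Fin m // lvl i = ℓ + 1} * Fintype.card {j : Fin m // lvl j = ℓ}) := by
  classical
  refine rank_hess0_graded_le_two_mul_sum_slot lvl N M hN hM hgr hnm H hH p _ fun ℓ hℓ C hC => ?_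
  -- data at the point
  set Z : Matrix (Fin m) (Fin m) ℂ := N.map (eval p) with hZ
  set K : Matrix (Fin m) (Fin m) ℂ := ∑ j ∈ Finset.range m, Z ^ j with hK
  set M0 : Matrix (Fin m) (Fin m) ℂ := Matrix.map
    (Matrix.of (fun i j => if lvl i = lvl j + (n - 1) then M i j else 0) : AffMat n m) (eval p) with hM0
  have hZgr : ∀ a b, lvl b ≠ lvl a + 1 → Z a b = 0 := by
    intro a b hab
    simp only [hZ, Matrix.map_apply, hgr a b hab, map_zero]
  have hZm : Z ^ m = 0 := by
    rw [hZ, ← Matrix.map_pow, pow_eq_zero_of_graded lvl N hgr]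
    ext i j
    simp
  have hKpiv : ∀ q, (q = pm ℓ ∨ q = pp ℓ) → ∀ i j, lvl i ≤ q → q ≤ lvl j →
      K i j = ∑ c ∈ Finset.univ.filter (fun c => lvl c = q), K i c * K c j :=
    fun q _ i j hiq hqj => resolvent_apply_eq_sum_level lvl Z hZgr hZm i j q hiq hqj
  have hM0dr : ∀ d v, M0 d v ≠ 0 → lvl d = lvl v + (n - 1) := by
    intro d v hdv
    by_contra hc
    apply hdv
    simp only [hM0, Matrix.map_apply, Matrix.of_apply, if_neg hc, map_zero]
  by_cases hA : adm ℓ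
  · rw [if_pos hA]
    obtain ⟨h1, h2, h3⟩ := hadm ℓ hA
    exact finrank_range_slot_le lvl K M0 (n - 1) ℓ (pm ℓ) (pp ℓ) hKpiv hM0dr h1 h2 h3 C hC
  · rw [if_neg hA]
    refine (Submodule.finrank_le _).trans ?_
    rw [Module.finrank_matrix]
    simp

end Summit.ValiantsHypothesis.ValiantsHypothesis.Theorems.GrenetZeonTwoDimCoefficients.GradedHessianPivots

end
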